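import Summits.ResolutionOfSingularities.ResolutionOfSingularities.Theorems.FrobeniusLadderFInjectiveMacaulayficationPencilExitTagCode3
import HarnessLib

/-!
# TASK 4b SOUNDNESS, the deep «half-half» codes 7 / 8 of ✓p694236 (`j = (p−1)/2`; per-letter `M₁ i + M₂ i + r i ≤ 2`, resp. `… + s i ≤ 2`, on `Z`): the `W`-chart is FULL at EVERY
# point `(w₀; c)` of the fibre line and the `U`-chart at the pole, `p` odd — completing the per-code family (codes 7/8 do not occur in the three certified fans of ✓p694236; filed so
# that future cure fans need no new soundness work)
# (crux `FInjectiveMacaulayfication` stmt-ResolutionOfSingularities-15315, chain w45a; RULING R23.8 (3); consumer res-L1-w45a-stub-3 TASK 4c; seat res-L1-w45a-stub-1 g15)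

[OURS · L1 W4.5a] Support file (`--supports stmt-ResolutionOfSingularities-15315 --as helper`); theorems only; unconditional; any field, every odd prime `p`. Nothing of the crux is
proved; no census row is asserted. AI-written (AI review is weaker than expert review).

WITNESS (code 7): `W^J·y^{J(M₁ + M₂ + r)|_Z}`, `J = (p−1)/2`: in the `W^J`-layer `C(p−1,J)·A′^J(w₀A′ − B′)^J` the pure `ρ`-power of `(−B′)^J = (−β)^J y^{J M₂|_Z}(ρy^{r|_Z} − σy^{s|_Z})^J`
(unique since `r|_Z ≠ s|_Z`, ✓p699538 `coeff_deep_target`); the `w₀`-terms cannot reach it since at a letter `i₀ ∈ Z` with `M₁ i₀ = 2` (forced unless `M₁|_Z ≤ 1` = code 2) the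
exponent is `2J < (J+1)·2` (✓p699538 `coeff_mul_pow_shift_eq`). Code 8 = code 7 with `r ↔ s`. At the pole no shift and no case split.
* §1 `pow_mul_neg_pow_comm`; §2 ★★ `fullCl_pencilChartW_deepHalf` (core, `χ = u·y^r + v·y^s`), ★★ `fullCl_pencilChartW_code7`, ★★ `fullCl_pencilChartW_code8`;
  §3 ★★ `fullCl_pencilChartU_pole_deepHalf / _code7 / _code8`.
[cite: Fedder1983, Thm. 1.12]
-/

set_option linter.dupNamespace false

noncomputable section

open AlgebraicGeometry IsLocalRing MvPolynomial
open scoped Pointwise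

namespace Summit.ResolutionOfSingularities.ResolutionOfSingularities.Theorems.FInjectiveMacaulayfication.PencilExitTagDeepHalf

open Summit.ResolutionOfSingularities.ResolutionOfSingularities.Theorems.FInjectiveMacaulayfication
open SliceableCentre PencilExitTagW PencilExitWitness PencilExitTagDeep

variable (k : Type) [Field k] {n : ℕ}

/-! ## §1 A sign bookkeeping lemma -/

/-- `x^m·(−y)^m = y^m·(−x)^m`. [plumbing] -/
theorem pow_mul_neg_pow_comm {R : Type} [CommRing R] (x y : R) (m : ℕ) : x ^ m * (-y) ^ m = y ^ m * (-x) ^ m := by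
  rw [neg_pow, neg_pow x]; ring

/-! ## §2 ★★ The `W`-chart, every `w₀` -/

set_option maxHeartbeats 800000 in
-- polynomial bookkeeping
/-- ★★ **DEEP HALF-HALF CORE, `W`-chart**: `Φ_W = (y^{M₁})⁺·W − (y^{M₂}(u·y^r + v·y^s))⁺` (`u ≠ 0`, `p` odd; no disjointness needed) is FULL at EVERY closed point `(w₀; c)` with
`M₁ i + M₂ i + r i ≤ 2` on `Z` and `r|_Z ≠ s|_Z`. Witness `W^J·y^{J(M₁+M₂+r)|_Z}`. [OURS · TASK 4b soundness; cite: Fedder1983, Thm. 1.12] -/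
theorem fullCl_pencilChartW_deepHalf (p : ℕ) [Fact p.Prime] [CharP k p] (hp2 : p ≠ 2) (M₁ M₂ r s : Fin n →₀ ℕ) (u v : k) (hu : u ≠ 0)
    (Φ : MvPolynomial (Fin (n + 1)) k)
    (hΦ : Φ = rename Fin.succ (monomial M₁ (1 : k)) * X 0 - rename Fin.succ (monomial M₂ (1 : k) * (C u * monomial r 1 + C v * monomial s 1))) (hΦp : Prime Φ)
    (c : Fin n → k) (w₀ : k) (y : Spec (.of (MvPolynomial (Fin (n + 1)) k ⧸ Ideal.span {Φ}))) (hy : y.asIdeal.IsMaximal)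
    (ha : y.asIdeal.comap (Ideal.Quotient.mk (Ideal.span {Φ})) =
      Ideal.span (Set.range (Fin.cons ((X 0 : MvPolynomial (Fin (n + 1)) k) - C w₀) fun i : Fin n => X i.succ - C (c i))))
    (htag : ∀ i, c i = 0 → M₁ i + M₂ i + r i ≤ 2) (hne : ∃ i, c i = 0 ∧ r i ≠ s i) :
    FullCl p ((Spec (.of (MvPolynomial (Fin (n + 1)) k ⧸ Ideal.span {Φ}))).presheaf.stalk y) := by
  classical
  -- if `M₁|_Z ≤ 1` this is code 2
  by_cases hM₁ : ∀ i, c i = 0 → M₁ i ≤ 1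
  · exact fullCl_pencilChartW_of_M₁_le_one k p M₁ _ Φ hΦ hΦp c w₀ y hy ha hM₁
  push Not at hM₁
  obtain ⟨i₀, hci₀, hM₁i₀⟩ := hM₁
  have hM₂r₀ : M₂ i₀ + r i₀ = 0 := by have := htag i₀ hci₀; omega
  have hp1 : 1 ≤ p := (Fact.out : p.Prime).one_lt.le
  have hJ := PencilExitTagCode3.two_mul_half p hp2
  set J := (p - 1) / 2 with hJdef
  set v₀ : Fin n → MvPolynomial (Fin n) k := fun i => if c i = 0 then X i else C (c i) with hv₀
  set a := M₁.filter fun i => c i = 0 with ha'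
  set b := M₂.filter fun i => c i = 0 with hb
  set r' := r.filter fun i => c i = 0 with hr'
  set s' := s.filter fun i => c i = 0 with hs'
  set α : k := ∏ i ∈ M₁.support with c i ≠ 0, c i ^ M₁ i with hα
  set β : k := ∏ i ∈ M₂.support with c i ≠ 0, c i ^ M₂ i with hβ
  set ρ : k := ∏ i ∈ r.support with c i ≠ 0, c i ^ r i with hρ
  set σ : k := ∏ i ∈ s.support with c i ≠ 0, c i ^ s i with hσ
  have hα0 : α ≠ 0 := theta0_scalar_ne_zero k c M₁
  have hβ0 : β ≠ 0 := theta0_scalar_ne_zero k c M₂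
  have hρ0 : ρ ≠ 0 := theta0_scalar_ne_zero k c r
  have hA : aeval v₀ (monomial M₁ (1 : k)) = monomial a 1 * C α := by rw [hv₀, theta0_monomial, mul_comm]
  have hB : aeval v₀ (monomial M₂ (1 : k) * (C u * monomial r 1 + C v * monomial s 1)) = monomial b (1 : k) * (C (β * ρ * u) * monomial r' 1 + C (β * σ * v) * monomial s' 1) := by
    rw [hv₀, theta0_binomial]
  have hrs' : r' ≠ s' := filter_ne_filter k c r s hne
  set d₀ : Fin n →₀ ℕ := J • a + J • (b + r') with hd₀
  refine fullCl_linearChart_of_subst k p _ _ Φ hΦ hΦp c w₀ y hy ha v₀ {i | c i = 0} (v0_shape k c) J (by omega) d₀ (fun i hci => ?_) ?_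
  · rw [Set.mem_setOf_eq] at hci
    rw [hd₀, Finsupp.add_apply, Finsupp.smul_apply, Finsupp.smul_apply, Finsupp.add_apply, hb, ha', hr', filter_apply_of_mem k c M₁ i hci, filter_apply_of_mem k c M₂ i hci,
      filter_apply_of_mem k c r i hci, smul_eq_mul, smul_eq_mul, ← Nat.mul_add]
    calc J * (M₁ i + (M₂ i + r i)) ≤ J * 2 := Nat.mul_le_mul_left _ (by have := htag i hci; omega)
      _ < p := by omega
  · rw [hA, hB, show p - 1 - J = J by omega]
    rw [coeff_mul_pow_shift_eq k a (C α) _ w₀ J J d₀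
      ⟨i₀, by
        rw [hd₀, Finsupp.add_apply, Finsupp.smul_apply, Finsupp.smul_apply, Finsupp.add_apply, hb, ha', hr', filter_apply_of_mem k c M₁ i₀ hci₀, filter_apply_of_mem k c M₂ i₀ hci₀,
          filter_apply_of_mem k c r i₀ hci₀, hM₂r₀, smul_eq_mul, smul_zero, add_zero, Nat.succ_mul]
        omega⟩]
    rw [mul_comm (monomial a (1 : k)) (C α), hd₀, coeff_deep_target k a b r' s' hrs' α (β * ρ * u) (β * σ * v) J J]
    exact mul_ne_zero (mul_ne_zero (pow_ne_zero _ (neg_ne_zero.2 one_ne_zero)) (pow_ne_zero _ hα0)) (pow_ne_zero _ (mul_ne_zero (mul_ne_zero hβ0 hρ0) hu))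

/-- ★★ **CODE 7** («deep half-half», `M₁ + M₂ + r ≤ 2` per letter on `Z`): `Φ_W = (y^{M₁})⁺·W − (y^{M₂}(y^r − y^s))⁺` is FULL at EVERY `(w₀; c)` when moreover `r|_Z ≠ s|_Z` (e.g. deep);
`p` odd. [OURS · TASK 4b soundness; cite: Fedder1983, Thm. 1.12] -/
theorem fullCl_pencilChartW_code7 (p : ℕ) [Fact p.Prime] [CharP k p] (hp2 : p ≠ 2) (M₁ M₂ r s : Fin n →₀ ℕ)
    (Φ : MvPolynomial (Fin (n + 1)) k)
    (hΦ : Φ = rename Fin.succ (monomial M₁ (1 : k)) * X 0 - rename Fin.succ (monomial M₂ (1 : k) * (monomial r 1 - monomial s 1))) (hΦp : Prime Φ)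
    (c : Fin n → k) (w₀ : k) (y : Spec (.of (MvPolynomial (Fin (n + 1)) k ⧸ Ideal.span {Φ}))) (hy : y.asIdeal.IsMaximal)
    (ha : y.asIdeal.comap (Ideal.Quotient.mk (Ideal.span {Φ})) =
      Ideal.span (Set.range (Fin.cons ((X 0 : MvPolynomial (Fin (n + 1)) k) - C w₀) fun i : Fin n => X i.succ - C (c i))))
    (htag : ∀ i, c i = 0 → M₁ i + M₂ i + r i ≤ 2) (hne : ∃ i, c i = 0 ∧ r i ≠ s i) :
    FullCl p ((Spec (.of (MvPolynomial (Fin (n + 1)) k ⧸ Ideal.span {Φ}))).presheaf.stalk y) :=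
  fullCl_pencilChartW_deepHalf k p hp2 M₁ M₂ r s 1 (-1) one_ne_zero Φ (by rw [hΦ, map_neg, C_1, one_mul, neg_one_mul, ← sub_eq_add_neg]) hΦp c w₀ y hy ha htag hne

/-- ★★ **CODE 8** (`M₁ + M₂ + s ≤ 2` per letter on `Z`): the same with `s` in place of `r`. [OURS · TASK 4b soundness; cite: Fedder1983, Thm. 1.12] -/
theorem fullCl_pencilChartW_code8 (p : ℕ) [Fact p.Prime] [CharP k p] (hp2 : p ≠ 2) (M₁ M₂ r s : Fin n →₀ ℕ)
    (Φ : MvPolynomial (Fin (n + 1)) k)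
    (hΦ : Φ = rename Fin.succ (monomial M₁ (1 : k)) * X 0 - rename Fin.succ (monomial M₂ (1 : k) * (monomial r 1 - monomial s 1))) (hΦp : Prime Φ)
    (c : Fin n → k) (w₀ : k) (y : Spec (.of (MvPolynomial (Fin (n + 1)) k ⧸ Ideal.span {Φ}))) (hy : y.asIdeal.IsMaximal)
    (ha : y.asIdeal.comap (Ideal.Quotient.mk (Ideal.span {Φ})) =
      Ideal.span (Set.range (Fin.cons ((X 0 : MvPolynomial (Fin (n + 1)) k) - C w₀) fun i : Fin n => X i.succ - C (c i))))
    (htag : ∀ i, c i = 0 → M₁ i + M₂ i + s i ≤ 2) (hne : ∃ i, c i = 0 ∧ r i ≠ s i) :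
    FullCl p ((Spec (.of (MvPolynomial (Fin (n + 1)) k ⧸ Ideal.span {Φ}))).presheaf.stalk y) :=
  fullCl_pencilChartW_deepHalf k p hp2 M₁ M₂ s r (-1) 1 (neg_ne_zero.2 one_ne_zero) Φ
    (by rw [hΦ, map_neg, C_1, one_mul, neg_one_mul, neg_add_eq_sub]) hΦp c w₀ y hy ha htag
    (by obtain ⟨i, hci, h⟩ := hne; exact ⟨i, hci, Ne.symm h⟩)

/-! ## §3 ★★ The pole `U = 0` -/

set_option maxHeartbeats 800000 in
-- polynomial bookkeeping
/-- ★★ **DEEP HALF-HALF CORE AT THE POLE**: `Φ_U = (y^{M₂}(u·y^r + v·y^s))⁺·U − (y^{M₁})⁺` is FULL at `(0; c)` with `M₁ i + M₂ i + r i ≤ 2` on `Z` and `r|_Z ≠ s|_Z` (`u ≠ 0`, `p` odd; no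
disjointness needed). Witness `U^J·y^{J(M₁+M₂+r)|_Z}`. [OURS · TASK 4b soundness; cite: Fedder1983, Thm. 1.12] -/
theorem fullCl_pencilChartU_pole_deepHalf (p : ℕ) [Fact p.Prime] [CharP k p] (hp2 : p ≠ 2) (M₁ M₂ r s : Fin n →₀ ℕ) (u v : k) (hu : u ≠ 0)
    (Φ : MvPolynomial (Fin (n + 1)) k)
    (hΦ : Φ = rename Fin.succ (monomial M₂ (1 : k) * (C u * monomial r 1 + C v * monomial s 1)) * X 0 - rename Fin.succ (monomial M₁ (1 : k))) (hΦp : Prime Φ)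
    (c : Fin n → k) (y : Spec (.of (MvPolynomial (Fin (n + 1)) k ⧸ Ideal.span {Φ}))) (hy : y.asIdeal.IsMaximal)
    (ha : y.asIdeal.comap (Ideal.Quotient.mk (Ideal.span {Φ})) =
      Ideal.span (Set.range (Fin.cons (X 0 : MvPolynomial (Fin (n + 1)) k) fun i : Fin n => X i.succ - C (c i))))
    (htag : ∀ i, c i = 0 → M₁ i + M₂ i + r i ≤ 2) (hne : ∃ i, c i = 0 ∧ r i ≠ s i) :
    FullCl p ((Spec (.of (MvPolynomial (Fin (n + 1)) k ⧸ Ideal.span {Φ}))).presheaf.stalk y) := by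
  classical
  have hp1 : 1 ≤ p := (Fact.out : p.Prime).one_lt.le
  have hJ := PencilExitTagCode3.two_mul_half p hp2
  set J := (p - 1) / 2 with hJdef
  set v₀ : Fin n → MvPolynomial (Fin n) k := fun i => if c i = 0 then X i else C (c i) with hv₀
  set a := M₁.filter fun i => c i = 0 with ha'
  set b := M₂.filter fun i => c i = 0 with hb
  set r' := r.filter fun i => c i = 0 with hr'
  set s' := s.filter fun i => c i = 0 with hs'
  set α : k := ∏ i ∈ M₁.support with c i ≠ 0, c i ^ M₁ i with hα
  set β : k := ∏ i ∈ M₂.support with c i ≠ 0, c i ^ M₂ i with hβ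
  set ρ : k := ∏ i ∈ r.support with c i ≠ 0, c i ^ r i with hρ
  set σ : k := ∏ i ∈ s.support with c i ≠ 0, c i ^ s i with hσ
  have hα0 : α ≠ 0 := theta0_scalar_ne_zero k c M₁
  have hβ0 : β ≠ 0 := theta0_scalar_ne_zero k c M₂
  have hρ0 : ρ ≠ 0 := theta0_scalar_ne_zero k c r
  have hA : aeval v₀ (monomial M₁ (1 : k)) = C α * monomial a 1 := by rw [hv₀, theta0_monomial]
  have hB : aeval v₀ (monomial M₂ (1 : k) * (C u * monomial r 1 + C v * monomial s 1)) = monomial b (1 : k) * (C (β * ρ * u) * monomial r' 1 + C (β * σ * v) * monomial s' 1) := by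
    rw [hv₀, theta0_binomial]
  have hrs' : r' ≠ s' := filter_ne_filter k c r s hne
  set d₀ : Fin n →₀ ℕ := J • a + J • (b + r') with hd₀
  refine fullCl_linearChart_pole_of_subst k p _ _ Φ hΦ hΦp c y hy ha v₀ {i | c i = 0} (v0_shape k c) J (by omega) d₀ (fun i hci => ?_) ?_
  · rw [Set.mem_setOf_eq] at hci
    rw [hd₀, Finsupp.add_apply, Finsupp.smul_apply, Finsupp.smul_apply, Finsupp.add_apply, hb, ha', hr', filter_apply_of_mem k c M₁ i hci, filter_apply_of_mem k c M₂ i hci,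
      filter_apply_of_mem k c r i hci, smul_eq_mul, smul_eq_mul, ← Nat.mul_add]
    calc J * (M₁ i + (M₂ i + r i)) ≤ J * 2 := Nat.mul_le_mul_left _ (by have := htag i hci; omega)
      _ < p := by omega
  · rw [hA, hB, show p - 1 - J = J by omega, pow_mul_neg_pow_comm, hd₀, coeff_deep_target k a b r' s' hrs' α (β * ρ * u) (β * σ * v) J J]
    exact mul_ne_zero (mul_ne_zero (pow_ne_zero _ (neg_ne_zero.2 one_ne_zero)) (pow_ne_zero _ hα0)) (pow_ne_zero _ (mul_ne_zero (mul_ne_zero hβ0 hρ0) hu))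

/-- ★★ **CODE 7 AT THE POLE.** [OURS · TASK 4b soundness; cite: Fedder1983, Thm. 1.12] -/
theorem fullCl_pencilChartU_pole_code7 (p : ℕ) [Fact p.Prime] [CharP k p] (hp2 : p ≠ 2) (M₁ M₂ r s : Fin n →₀ ℕ)
    (Φ : MvPolynomial (Fin (n + 1)) k)
    (hΦ : Φ = rename Fin.succ (monomial M₂ (1 : k) * (monomial r 1 - monomial s 1)) * X 0 - rename Fin.succ (monomial M₁ (1 : k))) (hΦp : Prime Φ)
    (c : Fin n → k) (y : Spec (.of (MvPolynomial (Fin (n + 1)) k ⧸ Ideal.span {Φ}))) (hy : y.asIdeal.IsMaximal)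
    (ha : y.asIdeal.comap (Ideal.Quotient.mk (Ideal.span {Φ})) =
      Ideal.span (Set.range (Fin.cons (X 0 : MvPolynomial (Fin (n + 1)) k) fun i : Fin n => X i.succ - C (c i))))
    (htag : ∀ i, c i = 0 → M₁ i + M₂ i + r i ≤ 2) (hne : ∃ i, c i = 0 ∧ r i ≠ s i) :
    FullCl p ((Spec (.of (MvPolynomial (Fin (n + 1)) k ⧸ Ideal.span {Φ}))).presheaf.stalk y) :=
  fullCl_pencilChartU_pole_deepHalf k p hp2 M₁ M₂ r s 1 (-1) one_ne_zero Φ (by rw [hΦ, map_neg, C_1, one_mul, neg_one_mul, ← sub_eq_add_neg]) hΦp c y hy ha htag hne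

/-- ★★ **CODE 8 AT THE POLE.** [OURS · TASK 4b soundness; cite: Fedder1983, Thm. 1.12] -/
theorem fullCl_pencilChartU_pole_code8 (p : ℕ) [Fact p.Prime] [CharP k p] (hp2 : p ≠ 2) (M₁ M₂ r s : Fin n →₀ ℕ)
    (Φ : MvPolynomial (Fin (n + 1)) k)
    (hΦ : Φ = rename Fin.succ (monomial M₂ (1 : k) * (monomial r 1 - monomial s 1)) * X 0 - rename Fin.succ (monomial M₁ (1 : k))) (hΦp : Prime Φ)
    (c : Fin n → k) (y : Spec (.of (MvPolynomial (Fin (n + 1)) k ⧸ Ideal.span {Φ}))) (hy : y.asIdeal.IsMaximal)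
    (ha : y.asIdeal.comap (Ideal.Quotient.mk (Ideal.span {Φ})) =
      Ideal.span (Set.range (Fin.cons (X 0 : MvPolynomial (Fin (n + 1)) k) fun i : Fin n => X i.succ - C (c i))))
    (htag : ∀ i, c i = 0 → M₁ i + M₂ i + s i ≤ 2) (hne : ∃ i, c i = 0 ∧ r i ≠ s i) :
    FullCl p ((Spec (.of (MvPolynomial (Fin (n + 1)) k ⧸ Ideal.span {Φ}))).presheaf.stalk y) :=
  fullCl_pencilChartU_pole_deepHalf k p hp2 M₁ M₂ s r (-1) 1 (neg_ne_zero.2 one_ne_zero) Φ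
    (by rw [hΦ, map_neg, C_1, one_mul, neg_one_mul, neg_add_eq_sub]) hΦp c y hy ha htag
    (by obtain ⟨i, hci, h⟩ := hne; exact ⟨i, hci, Ne.symm h⟩)

end Summit.ResolutionOfSingularities.ResolutionOfSingularities.Theorems.FInjectiveMacaulayfication.PencilExitTagDeepHalf

end
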